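import Mathlib
import Literature.Analysis.FluidPDE.VorticityCalculus
import Literature.Analysis.FluidPDE.TaoEnstrophyLocalisation
import Literature.Analysis.FluidPDE.NSWeakStrongUniquenessProofs
import Literature.Analysis.FluidPDE.BKMClassGradientContinuity
import Literature.Analysis.FluidPDE.BKMClassEnstrophyContinuity
import HarnessLib

/-!
# Shelf 1574, LINE 7 twin `lamb_budget_vorticity`: the pointwise-in-time STRETCHING SPLIT
# (tools for `stub_stretchingSplit`)

Helper file (`--supports stmt-NavierStokesRegularity-1574 --as helper`). The one-slice inequality behind
ns-idea-9's twin engine `StretchingSplit` of `Cruxes/EnstrophyQuarterLaw/Lines/lamb_budget_vorticity.lean`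
(idea-crit-8 V30a: "StretchingSplit TRUE (M) and CLEANER than the velocity engine"): for a divergence-free `C²`
field `v` on `ℝ³` with `v, Dv, D²v ∈ L²`, a vorticity threshold `λ ≥ 0`, a gradient bound `‖∇v‖ ≤ g` and the
super-level set `W = {λ < |curl v|}` of finite measure,

  `∫ ⟪ω, ∇v ω⟫ ≤ λ · ∫ |ω|² + |W| · ‖curlCLM‖² · g³`        (`stretch_le_split`).

PROOF. Pointwise `⟪ω, ∇v ω⟫ ≤ |ω|² ‖∇v‖`. On the LOW set `|ω| ≤ λ`:
`|ω|² ‖∇v‖ ≤ λ |ω| ‖∇v‖ ≤ λ |ω| |∇v|_F ≤ (λ/2)(|ω|² + |∇v|²_F)` (operator norm ≤ Frobenius norm, AM–GM); on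
the HIGH set `W`: `|ω| ≤ ‖curlCLM‖ ‖∇v‖ ≤ ‖curlCLM‖ g`, so `|ω|² ‖∇v‖ ≤ ‖curlCLM‖² g³`. Integrating the
pointwise bound `⟪ω, ∇v ω⟫ ≤ (λ/2)(|ω|² + |∇v|²_F) + 1_W ‖curlCLM‖² g³` and using the div–curl identity
`∫ |∇v|²_F = ∫ |ω|²` (`integral_frobeniusNormSq_fderiv_eq_integral_norm_curl_sq`) gives the claim; if the
stretching integrand were not integrable its Bochner integral is `0 ≤` the right-hand side. This is the
"low set absorbed / high set = measure × sup³" step of the twin, with the crude bound `|ω·Sω| ≤ |ω|²‖∇v‖`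
(no strain identity), which is why the twin's admissible threshold is `c₂ < 1/4` (`a = 2c₂ < 1/2`).

HONEST FRAMING: one inequality about one smooth field; nothing here bears on the regularity problem.
No summit statement is proved.
-/

noncomputable section

-- the summit-side namespace repeats a component by design (D-0017)
set_option linter.dupNamespace false

namespace Summit.NavierStokesRegularity.NavierStokesRegularity.Theorems.EnstrophyQuarterLaw.LambBudget

open Set MeasureTheory Filter Topology
open scoped RealInnerProductSpace ENNReal NNReal
open Literature.Analysis.FluidPDE

/-- `|∇v|²_F` is integrable for a `C²` field with `Dv ∈ L²` (`|L|²_F ≤ 3‖L‖²` on `ℝ³`). [folklore] -/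
theorem integrable_frobeniusNormSq_fderiv_of_lintegral
    {v : EuclideanSpace ℝ (Fin 3) → EuclideanSpace ℝ (Fin 3)} (hv : ContDiff ℝ 2 v)
    (h1 : ∫⁻ x, ‖iteratedFDeriv ℝ 1 v x‖ₑ ^ 2 < ⊤) :
    Integrable (fun x => frobeniusNormSq (fderiv ℝ v x)) := by
  have h1' : ∫⁻ x, ‖fderiv ℝ v x‖ₑ ^ 2 < ⊤ := by
    refine lt_of_le_of_lt (le_of_eq (lintegral_congr fun x => ?_)) h1
    rw [← ofReal_norm, ← norm_iteratedFDeriv_one (𝕜 := ℝ) (f := v), ofReal_norm]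
  have hfin : ∫⁻ x, ENNReal.ofReal (frobeniusNormSq (fderiv ℝ v x)) < ⊤ := by
    refine lt_of_le_of_lt (lintegral_mono fun x => ofReal_frobeniusNormSq_le (fderiv ℝ v x)) ?_
    rw [lintegral_const_mul' _ _ (by norm_num)]
    exact ENNReal.mul_lt_top (by norm_num) h1'
  have hS : Continuous fun x => frobeniusNormSq (fderiv ℝ v x) :=
    continuous_frobeniusNormSq_fderiv hv (by norm_num)
  refine ⟨hS.aestronglyMeasurable, (hasFiniteIntegral_iff_enorm).2 ?_⟩
  refine lt_of_le_of_lt (le_of_eq (lintegral_congr fun x => ?_)) hfin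
  rw [Real.enorm_eq_ofReal (frobeniusNormSq_nonneg _)]

/-- **The pointwise stretching split** (the inequality, for every `x`): with `ω = curl v`, `A = ∇v(x)`,
`κ = ‖curlCLM‖`, threshold `λ ≥ 0`, gradient bound `‖A‖ ≤ g` and `W = {λ < |ω|}`,
`⟪ω, A ω⟫ ≤ (λ/2)(|ω|² + |A|²_F) + 1_W(x) κ² g³`. [folklore] -/
theorem inner_curl_fderiv_curl_le_split
    (v : EuclideanSpace ℝ (Fin 3) → EuclideanSpace ℝ (Fin 3)) {lam g : ℝ} (hlam : 0 ≤ lam)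
    (hg : ∀ x, ‖fderiv ℝ v x‖ ≤ g) (x : EuclideanSpace ℝ (Fin 3)) :
    ⟪curl v x, fderiv ℝ v x (curl v x)⟫ ≤
      lam / 2 * (‖curl v x‖ ^ 2 + frobeniusNormSq (fderiv ℝ v x)) +
        {y | lam < ‖curl v y‖}.indicator (fun _ => ‖(curlCLM :
          (EuclideanSpace ℝ (Fin 3) →L[ℝ] EuclideanSpace ℝ (Fin 3)) →L[ℝ] EuclideanSpace ℝ (Fin 3))‖ ^ 2 *
            g ^ 3) x := by
  set κ : ℝ := ‖(curlCLM :
    (EuclideanSpace ℝ (Fin 3) →L[ℝ] EuclideanSpace ℝ (Fin 3)) →L[ℝ] EuclideanSpace ℝ (Fin 3))‖ with hκ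
  set A := fderiv ℝ v x with hA
  set w := curl v x with hw
  have hA0 : 0 ≤ ‖A‖ := norm_nonneg _
  have hw0 : 0 ≤ ‖w‖ := norm_nonneg _
  have hF0 : 0 ≤ frobeniusNormSq A := frobeniusNormSq_nonneg _
  have h1 : ⟪w, A w⟫ ≤ ‖w‖ ^ 2 * ‖A‖ := by
    calc ⟪w, A w⟫ ≤ ‖w‖ * ‖A w‖ := real_inner_le_norm _ _
      _ ≤ ‖w‖ * (‖A‖ * ‖w‖) := mul_le_mul_of_nonneg_left (ContinuousLinearMap.le_opNorm _ _) hw0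
      _ = ‖w‖ ^ 2 * ‖A‖ := by ring
  by_cases hx : x ∈ {y | lam < ‖curl v y‖}
  · rw [indicator_of_mem hx]
    have hwle : ‖w‖ ≤ κ * ‖A‖ := norm_curl_le v x
    have hκ0 : 0 ≤ κ := by
      rw [hκ]
      exact norm_nonneg (curlCLM :
        (EuclideanSpace ℝ (Fin 3) →L[ℝ] EuclideanSpace ℝ (Fin 3)) →L[ℝ] EuclideanSpace ℝ (Fin 3))
    have hAg : ‖A‖ ≤ g := hg x
    have h2 : ‖w‖ ^ 2 * ‖A‖ ≤ κ ^ 2 * g ^ 3 := by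
      calc ‖w‖ ^ 2 * ‖A‖ ≤ (κ * ‖A‖) ^ 2 * ‖A‖ := by gcongr
        _ = κ ^ 2 * ‖A‖ ^ 3 := by ring
        _ ≤ κ ^ 2 * g ^ 3 := by gcongr
    have hlow : 0 ≤ lam / 2 * (‖w‖ ^ 2 + frobeniusNormSq A) := by positivity
    linarith
  · rw [indicator_of_notMem hx, add_zero]
    have hwlam : ‖w‖ ≤ lam := by
      simp only [mem_setOf_eq, not_lt] at hx
      exact hx
    set s : ℝ := Real.sqrt (frobeniusNormSq A) with hs
    have hs0 : 0 ≤ s := Real.sqrt_nonneg _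
    have hs2 : s ^ 2 = frobeniusNormSq A := Real.sq_sqrt hF0
    have hAs : ‖A‖ ≤ s := opNorm_le_sqrt_frobeniusNormSq A
    calc ⟪w, A w⟫ ≤ ‖w‖ ^ 2 * ‖A‖ := h1
      _ = ‖w‖ * ‖w‖ * ‖A‖ := by ring
      _ ≤ lam * ‖w‖ * s := by gcongr
      _ ≤ lam / 2 * (‖w‖ ^ 2 + s ^ 2) := by nlinarith [sq_nonneg (‖w‖ - s), mul_nonneg hlam (sq_nonneg (‖w‖ - s))]
      _ = lam / 2 * (‖w‖ ^ 2 + frobeniusNormSq A) := by rw [hs2]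

/-- **The stretching split, integrated over one slice.** For a divergence-free `C²` field `v` on `ℝ³` with
`v, Dv, D²v ∈ L²`, a threshold `λ ≥ 0`, a gradient bound `‖∇v‖ ≤ g` and the super-level set
`W = {λ < |curl v|}` of finite measure:
`∫ ⟪ω, ∇v ω⟫ ≤ λ ∫ |ω|² + |W| · ‖curlCLM‖² g³`. [folklore] -/
theorem stretch_le_split
    {v : EuclideanSpace ℝ (Fin 3) → EuclideanSpace ℝ (Fin 3)} (hv : ContDiff ℝ 2 v)
    (hdiv : VectorCalculus.IsDivFree v) (h0 : ∫⁻ x, ‖v x‖ₑ ^ 2 < ⊤)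
    (h1 : ∫⁻ x, ‖iteratedFDeriv ℝ 1 v x‖ₑ ^ 2 < ⊤) (h2 : ∫⁻ x, ‖iteratedFDeriv ℝ 2 v x‖ₑ ^ 2 < ⊤)
    {lam g : ℝ} (hlam : 0 ≤ lam) (hg : ∀ x, ‖fderiv ℝ v x‖ ≤ g)
    (hW : volume {y | lam < ‖curl v y‖} ≠ ⊤) :
    ∫ x, ⟪curl v x, fderiv ℝ v x (curl v x)⟫ ≤
      lam * (∫ x, ‖curl v x‖ ^ 2) +
        (volume {y | lam < ‖curl v y‖}).toReal * (‖(curlCLM :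
          (EuclideanSpace ℝ (Fin 3) →L[ℝ] EuclideanSpace ℝ (Fin 3)) →L[ℝ] EuclideanSpace ℝ (Fin 3))‖ ^ 2 *
            g ^ 3) := by
  set κ : ℝ := ‖(curlCLM :
    (EuclideanSpace ℝ (Fin 3) →L[ℝ] EuclideanSpace ℝ (Fin 3)) →L[ℝ] EuclideanSpace ℝ (Fin 3))‖ with hκ
  set W : Set (EuclideanSpace ℝ (Fin 3)) := {y | lam < ‖curl v y‖} with hWdef
  have hv1 : ContDiff ℝ 1 v := hv.of_le (by norm_cast)
  have hg0 : 0 ≤ g := (norm_nonneg _).trans (hg 0)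
  have hκ0 : 0 ≤ κ := by
    rw [hκ]
    exact norm_nonneg (curlCLM :
      (EuclideanSpace ℝ (Fin 3) →L[ℝ] EuclideanSpace ℝ (Fin 3)) →L[ℝ] EuclideanSpace ℝ (Fin 3))
  -- measurability and integrability of the pieces
  have hWm : MeasurableSet W :=
    (isOpen_lt continuous_const (continuous_curl hv1).norm).measurableSet
  have hintC : Integrable (fun x => ‖curl v x‖ ^ 2) := (integrable_norm_curl_sq hv h1).1
  have hintF : Integrable (fun x => frobeniusNormSq (fderiv ℝ v x)) :=
    integrable_frobeniusNormSq_fderiv_of_lintegral hv h1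
  have hind : Integrable (W.indicator fun _ => κ ^ 2 * g ^ 3) :=
    (integrableOn_const hW).integrable_indicator hWm
  have hA : Integrable (fun x => lam / 2 * (‖curl v x‖ ^ 2 + frobeniusNormSq (fderiv ℝ v x))) :=
    (hintC.add hintF).const_mul (lam / 2)
  have hrhs : Integrable (fun x => lam / 2 * (‖curl v x‖ ^ 2 + frobeniusNormSq (fderiv ℝ v x)) +
      W.indicator (fun _ => κ ^ 2 * g ^ 3) x) :=
    hA.add hind
  -- the value of the right-hand side
  have hF : ∫ x, frobeniusNormSq (fderiv ℝ v x) = ∫ x, ‖curl v x‖ ^ 2 :=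
    integral_frobeniusNormSq_fderiv_eq_integral_norm_curl_sq hv hdiv h0 h1 h2
  have hval : ∫ x, (lam / 2 * (‖curl v x‖ ^ 2 + frobeniusNormSq (fderiv ℝ v x)) +
      W.indicator (fun _ => κ ^ 2 * g ^ 3) x) =
      lam * (∫ x, ‖curl v x‖ ^ 2) + (volume W).toReal * (κ ^ 2 * g ^ 3) := by
    rw [integral_add hA hind, integral_const_mul,
      integral_add hintC hintF, hF, integral_indicator_const _ hWm, smul_eq_mul, measureReal_def]
    ring
  have hZ0 : 0 ≤ ∫ x, ‖curl v x‖ ^ 2 := integral_nonneg fun x => by positivity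
  by_cases hint : Integrable (fun x => ⟪curl v x, fderiv ℝ v x (curl v x)⟫)
  · calc ∫ x, ⟪curl v x, fderiv ℝ v x (curl v x)⟫
        ≤ ∫ x, (lam / 2 * (‖curl v x‖ ^ 2 + frobeniusNormSq (fderiv ℝ v x)) +
            W.indicator (fun _ => κ ^ 2 * g ^ 3) x) :=
          integral_mono hint hrhs fun x => inner_curl_fderiv_curl_le_split v hlam hg x
      _ = lam * (∫ x, ‖curl v x‖ ^ 2) + (volume W).toReal * (κ ^ 2 * g ^ 3) := hval
  · rw [integral_undef hint]
    positivity

end Summit.NavierStokesRegularity.NavierStokesRegularity.Theorems.EnstrophyQuarterLaw.LambBudget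

end
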